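import Literature.Geometry.Kaehler.ComplexTorusSubtorusIntersectionNumber
import Literature.Geometry.Kaehler.ComplexTorusSubtorusDegree
import HarnessLib

/-!
# Restriction of the class of a complementary subtorus: `ι_Y^* cl(Z) = #(Y ∩ Z) · [pt_Y]`

Layer `Literature/Geometry/Kaehler`, namespace `Literature.Geometry.Kaehler.ComplexTorus`; lane `lit-hodgefound`
(Track 2 foundations library), prover seat `lit-hodgefound-p36` (gen 9, row g9-#7). Junction of row Q719
(`ComplexTorusSubtorusIntersectionNumber`: Bézout `∫_X [Y] ∧ [Z] = sign_Y sign_Z · #(Y ∩ Z)` for complex subtori of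
complementary dimensions) with row g9-#3 (`ComplexTorusSubtorusDegree`: the restriction formula
`∫_X α ∧ [Z_{λ′∘eY}] = sign_Y(eY) · ∫_Y ι_Y^*α`, Arapura (5.6.1)) and row A4-26 (`ComplexTorusSelfIntersection`: a top
invariant form is its integral times `vol`, `eq_torusIntegral_smul_volumeForm`) — the transversal counterpart of row
g9-#5's `ι_Y^* cl(Y) = 0`; everything consumed BY NAME.

## Sources (held copies, pages opened)

* W. Fulton, *Intersection Theory* [held `book:fultonnd-intersection-theory`], §8.2 p0130 L6–L12 (Prop. 8.2: for a
  proper component `Z` of `V ∩ W`, "(c) If the local ring of `V ∩ W` at `Z` is Cohen–Macaulay then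
  `i(Z, V·W; X) = l(𝒪_{Z,V∩W})`", multiplicity `1` at a transversal point), §8.1 (the refined Gysin pull-back
  `i^!`, `V · W = Σ i(Z) [Z]`); §19.2 Cor. 19.2 (b) (p0365: `cl` is compatible with Gysin pull-backs).
* D. Arapura, *Algebraic Geometry over the Complex Numbers* (2012), §5.6 (5.6.1) "`∫_Y i^*α = ∫_X [Y] ∪ α`",
  Prop. 5.6.3 and Exercise 5.6.6 (transverse complex submanifolds meet with `i_p = +1`) [held copy p0115–p0117].

## What is proved (TORUS level, invariant forms; theorems only — no definition, no named fact)

`X = E/Φ(ℤ^ι)`; complex lattice subspaces `V` (`Y = π(ΦV)`, `rk(Λ ∩ V) = a`) and `W` (`Z = π(ΦW)`, `rk(Λ ∩ W) = b`) with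
`a + b = rk Λ`; `ι_Y^*` the restriction to `Φ(V)`; `[pt_Y] = vol_Y = volumeForm (subtorusPeriod Φ V hV hVc) eV`
(row A4-18: the class of a point is `vol`, `cycleFormOfFrame_point`).

* `torusIntegral_restrict_cycleFormOfFrame_adapted`: **`∫_Y ι_Y^*[Z_{λ′_W∘eW}] = sign_Z(eW) · #(Y ∩ Z)`** ((5.6.1) +
  Bézout).
* **`restrict_cycleFormOfFrame_adapted_eq_smul_volumeForm`: `ι_Y^*[Z_{λ′_W∘eW}] = (sign_Z(eW) · #(Y ∩ Z)) • vol_Y`**, and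
  ON THE NOSE for row Q672's positively oriented datum: **`ι_Y^* cl(Z) = #(Y ∩ Z) • [pt_Y]`**
  (`SubtorusFrame.restrict_cycleForm_ofSubspace_eq_natCard_smul_volumeForm`) — the class of the `0`-cycle `Y ∩ Z` on `Y`,
  each transversal point counted once (Prop. 8.2 (c) / Exercise 5.6.6); in `H^{top}(Y, ℚ)` through row Q247's
  `restrictForms` (`restrictForms_cycleFormOfFrame_adapted_eq_smul`).
-/

noncomputable section

open Module Function

namespace Literature.Geometry.Kaehler

namespace ComplexTorus

section RestrictComplementary

universe uE

variable {ι : Type*} [Fintype ι] [DecidableEq ι] {E : Type uE} [NormedAddCommGroup E] [NormedSpace ℂ E]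
  (Φ : (ι → ℝ) ≃L[ℝ] E) {V W : Submodule ℝ (ι → ℝ)} (hV : IsLatticeSubspace V) (hVc : IsComplexSubspace Φ V)
  (hW : IsLatticeSubspace W) (hWc : IsComplexSubspace Φ W) {a b : ℕ}

/-- **`∫_Y ι_Y^*[Z_{λ′_W ∘ eW}] = sign_Z(eW) · #(Y ∩ Z)`**: the integral over `Y = π(ΦV)` of the restricted class of a
complementary subtorus `Z = π(ΦW)` counts the intersection points ((5.6.1): `= sign_Y(eV) ∫_X cl(Z) ∧ [Z_{λ′_V∘eV}]`,
then Bézout). [cite: Arapura2012, §5.6 (5.6.1) and Prop. 5.6.3 / Exercise 5.6.6 (p0115–p0117)] [cite: Fulton1998, §8.2 Prop. 8.2 (c) (p0130 L6–L12)] -/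
theorem torusIntegral_restrict_cycleFormOfFrame_adapted (e₁ : Fin (b + a) ≃ ι) (eV : Fin a ≃ Fin (subRank V))
    (eW : Fin b ≃ Fin (subRank W)) :
    torusIntegral (subtorusPeriod Φ V hV hVc) eV
        ((cycleFormOfFrame Φ e₁ fun j ↦ adaptedBasis W (adaptedEmb W (eW j))).compContinuousLinearMap
          (((cxSpan Φ V).subtypeL).restrictScalars ℝ)) =
      ((orientationSign (subtorusPeriod Φ W hW hWc) eW * (Nat.card ↥(subtorus Φ V ⊓ subtorus Φ W) : ℤ) : ℤ) : ℂ) := by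
  have e : Fin (a + b) ≃ ι := (finCongr (Nat.add_comm a b)).trans e₁
  have h := torusIntegral_wedge_cycleFormOfFrame_adapted Φ V hV hVc e eV
    (cycleFormOfFrame Φ e₁ fun j ↦ adaptedBasis W (adaptedEmb W (eW j)))
  rw [torusIntegral_cycleForm_wedge_cycleForm_eq_sign_mul_natCard Φ hW hWc hV hVc e₁ e eW eV, inf_comm] at h
  have hs : (orientationSign (subtorusPeriod Φ V hV hVc) eV : ℂ) * orientationSign (subtorusPeriod Φ V hV hVc) eV = 1 := by
    exact_mod_cast orientationSign_mul_self (subtorusPeriod Φ V hV hVc) eV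
  have key : torusIntegral (subtorusPeriod Φ V hV hVc) eV
      ((cycleFormOfFrame Φ e₁ fun j ↦ adaptedBasis W (adaptedEmb W (eW j))).compContinuousLinearMap
        (((cxSpan Φ V).subtypeL).restrictScalars ℝ)) =
      (orientationSign (subtorusPeriod Φ V hV hVc) eV : ℂ) *
        ((orientationSign (subtorusPeriod Φ V hV hVc) eV : ℂ) *
          torusIntegral (subtorusPeriod Φ V hV hVc) eV
            ((cycleFormOfFrame Φ e₁ fun j ↦ adaptedBasis W (adaptedEmb W (eW j))).compContinuousLinearMap
              (((cxSpan Φ V).subtypeL).restrictScalars ℝ))) := by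
    rw [← mul_assoc, hs, one_mul]
  rw [key, ← h]
  push_cast
  linear_combination ((orientationSign (subtorusPeriod Φ W hW hWc) eW : ℂ) *
    (Nat.card ↥(subtorus Φ V ⊓ subtorus Φ W) : ℂ)) * hs

/-- **`ι_Y^*[Z_{λ′_W ∘ eW}] = (sign_Z(eW) · #(Y ∩ Z)) • vol_Y`** — the restriction to `Y` of the class of a complementary
subtorus is a top form on `Y`, hence its integral times the point class `vol_Y = [pt_Y]`
(`eq_torusIntegral_smul_volumeForm`). [cite: Fulton1998, §8.2 Prop. 8.2 (c) (p0130 L6–L12) and §8.1] [cite: Arapura2012, §5.6 Prop. 5.6.3 / Exercise 5.6.6 (p0116–p0117)] -/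
theorem restrict_cycleFormOfFrame_adapted_eq_smul_volumeForm (e₁ : Fin (b + a) ≃ ι) (eV : Fin a ≃ Fin (subRank V))
    (eW : Fin b ≃ Fin (subRank W)) :
    (cycleFormOfFrame Φ e₁ fun j ↦ adaptedBasis W (adaptedEmb W (eW j))).compContinuousLinearMap
        (((cxSpan Φ V).subtypeL).restrictScalars ℝ) =
      ((orientationSign (subtorusPeriod Φ W hW hWc) eW * (Nat.card ↥(subtorus Φ V ⊓ subtorus Φ W) : ℤ) : ℤ) : ℂ) •
        volumeForm (subtorusPeriod Φ V hV hVc) eV := by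
  rw [← torusIntegral_restrict_cycleFormOfFrame_adapted Φ hV hVc hW hWc e₁ eV eW]
  exact eq_torusIntegral_smul_volumeForm (subtorusPeriod Φ V hV hVc) eV _

/-- **`ι_Y^* cl(Z) = #(Y ∩ Z) • [pt_Y]` ON THE NOSE** for row Q672's canonical class `cl(Z)` of the positively oriented
datum `SubtorusFrame.ofSubspace Φ W … eW hposW` (any enumeration `eV` of `Λ ∩ V` on the right: `vol_Y` does not depend on
it, `volumeForm_eq_volumeForm`): the class of the reduced `0`-cycle `Y ∩ Z` on `Y` — each transversal intersection
point of the complex submanifolds `Y`, `Z` counts `+1`. [cite: Fulton1998, §8.2 Prop. 8.2 (c) (p0130 L6–L12)] [cite: Arapura2012, §5.6 Prop. 5.6.3 / Exercise 5.6.6 (p0116–p0117)] -/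
theorem SubtorusFrame.restrict_cycleForm_ofSubspace_eq_natCard_smul_volumeForm (e₁ : Fin (b + a) ≃ ι)
    (eV : Fin a ≃ Fin (subRank V)) {eW : Fin b ≃ Fin (subRank W)}
    (hposW : orientationSign (subtorusPeriod Φ W hW hWc) eW = 1) :
    ((SubtorusFrame.ofSubspace Φ W hW hWc eW hposW).cycleForm e₁).compContinuousLinearMap
        (((cxSpan Φ V).subtypeL).restrictScalars ℝ) =
      (Nat.card ↥(subtorus Φ V ⊓ subtorus Φ W) : ℂ) • volumeForm (subtorusPeriod Φ V hV hVc) eV := by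
  rw [SubtorusFrame.cycleForm, SubtorusFrame.ofSubspace_frame,
    restrict_cycleFormOfFrame_adapted_eq_smul_volumeForm Φ hV hVc hW hWc e₁ eV eW, hposW, one_mul, Int.cast_natCast]

/-- **In `H^{2 dim Y}(Y, ℚ)`: `ι_Y^*[Z_{λ′_W∘eW}] = (sign_Z(eW) · #(Y ∩ Z)) • [pt_Y]`** through row Q247's restriction map
`restrictForms`. [cite: Fulton1998, §8.2 Prop. 8.2 (c) (p0130 L6–L12)] [cite: Arapura2012, §5.6 Prop. 5.6.3 (p0116)] -/
theorem restrictForms_cycleFormOfFrame_adapted_eq_smul (e₁ : Fin (b + a) ≃ ι) (eV : Fin a ≃ Fin (subRank V))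
    (eW : Fin b ≃ Fin (subRank W)) :
    restrictForms Φ V hV hVc a
        ⟨cycleFormOfFrame Φ e₁ fun j ↦ adaptedBasis W (adaptedEmb W (eW j)), cycleFormOfFrame_mem_rationalForms Φ e₁ _⟩ =
      (orientationSign (subtorusPeriod Φ W hW hWc) eW * (Nat.card ↥(subtorus Φ V ⊓ subtorus Φ W) : ℤ)) •
        (⟨volumeForm (subtorusPeriod Φ V hV hVc) eV,
          mem_rationalForms_of_mem_integralForms _ (volumeForm_mem_integralForms (subtorusPeriod Φ V hV hVc) eV)⟩ :
          rationalForms (subtorusPeriod Φ V hV hVc) a) := by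
  refine Subtype.ext ?_
  have hz : ∀ (s : ℤ) (γ : rationalForms (subtorusPeriod Φ V hV hVc) a),
      ((s • γ : rationalForms (subtorusPeriod Φ V hV hVc) a) : cxSpan Φ V [⋀^Fin a]→L[ℝ] ℂ) =
        (s : ℂ) • (γ : cxSpan Φ V [⋀^Fin a]→L[ℝ] ℂ) := fun s γ ↦ by
    ext v
    simp
  rw [coe_restrictForms_apply, realRep_subtorusMatrix, hz]
  exact restrict_cycleFormOfFrame_adapted_eq_smul_volumeForm Φ hV hVc hW hWc e₁ eV eW

end RestrictComplementary

end ComplexTorus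

end Literature.Geometry.Kaehler

end
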